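import Mathlib
import Summits.ResolutionOfSingularities.ResolutionOfSingularities.Theorems.HomologicalConductorPersistenceCyclicQuotientAddCover
import Summits.ResolutionOfSingularities.ResolutionOfSingularities.Theorems.HomologicalConductorPersistenceAddCoverFamily
import HarnessLib

/-!
# Rung S-2 `PersistenceSurface` (stmt-19970), stub C1 (`Sat₄`) — the ISOTYPIC SPLITTING of `k[u,v]` over
# `U = k[u,v]^{μ_n(1,q)}` as an isomorphism of `U`-modules `k[u,v]|_U ≅ Π_a M_a`
# (chain W4.4b, seat res-L1-w44b-stub-4 gen 6; T-V package part 18)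

[OURS · L1 w44b · rung S-2] Nothing here is a statement of the manuscript under review (Hironaka 2017);
AI-written, weaker than expert review.

Part 17 (`…PersistenceAddCoverFamily.cohomologyAnnihilator_eq_of_summandData`) reads the `Sat₄` certificate at a
quotient stage off PER-SUMMAND data, starting from a splitting `e : V ≅ Π a, M a` of the Auslander module.  For the
cyclic quotient surface `U = k[u,v]^{μ_n(1,q)}` (setting of parts 13–16: `ζ` a primitive `n`-th root of unity in
`k`, `n ∈ kˣ`, `gcd(q,n) = 1`, `σ₀ : u ↦ ζu, v ↦ ζ^q v`, `U = {p | σ₀ p = p}`) this file supplies that splitting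
with the summands the chain's engines use:

* **`exists_isotypic_splitting`** — there are `U`-submodules `M a ⊆ k[u,v]|_U` (`a : ZMod n`) with
  `p ∈ M a ↔ σ₀ p = ζ^a · p` (the modules of semi-invariants `M_a = ⊕ k·uⁱvʲ`, `i + qj ≡ a`; `M 0 = U`) and an
  isomorphism of `U`-modules **`k[u,v]|_U ≅ Π a, M a`** (isotypic projectors `π_a = n⁻¹ ∑_g ζ^{−ag} σ_g`, both
  orthogonalities of the bicharacter `ζ^{ag}`).
* **`cohomologyAnnihilator_eq_four_of_isotypicData`** — parts 16 + 17 assembled at `1/n(1,q)`: given, for the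
  modules `M a` of the splitting, first syzygies `K a` with `K a ∈ add ((Π t, M (ψ t)) ⊕ U)` for a distinguished
  sub-family `ψ : κ → ZMod n`, and retracts `M (ψ t) | K (ψ (s t))`, then `ca(U) = ca⁴(U)` and
  `x ∈ ca(U) ↔ ∀ t, x ∈ s̲ann(M (ψ t))`.  With res-L1-w44b-idea-1's SC-TORIC §2(e) data — `ψ t = n − i_t`, `K a`
  from the greedy syzygy formula, the block-lemma retracts — this is `ca(U) = ca⁴(U) = ⋂_t M_{i_t}M_{n−i_t}` on the
  whole cyclic class; those two inputs are what remains to be typed.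

References: Iyengar–Takahashi, IMRN 2016, arXiv:1404.1476 [`IyengarTakahashi2014`] (vocabulary); folklore
(isotypic decomposition for a finite abelian group of invertible order).
-/

-- single-problem summit: the doubled namespace component `ResolutionOfSingularities` is forced
set_option linter.dupNamespace false

noncomputable section

open CategoryTheory Literature.RingTheory.CohomologyAnnihilator MvPolynomial
open Summit.ResolutionOfSingularities.ResolutionOfSingularities.Theorems.NoZeno.SandwichCluster
open Summit.ResolutionOfSingularities.ResolutionOfSingularities.Theorems.HomologicalConductor.PersistenceCyclicTransferFamily
open Summit.ResolutionOfSingularities.ResolutionOfSingularities.Theorems.HomologicalConductor.PersistenceCyclicTransferAbelianBicharacter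
open Summit.ResolutionOfSingularities.ResolutionOfSingularities.Theorems.HomologicalConductor.PersistenceCyclicTransferAbelianPairing
open Summit.ResolutionOfSingularities.ResolutionOfSingularities.Theorems.HomologicalConductor.PersistenceCyclicQuotientSurface
open Summit.ResolutionOfSingularities.ResolutionOfSingularities.Theorems.HomologicalConductor.PersistenceCyclicQuotientSurfaceFinite
open Summit.ResolutionOfSingularities.ResolutionOfSingularities.Theorems.HomologicalConductor.PersistenceAuslanderAddCover
open Summit.ResolutionOfSingularities.ResolutionOfSingularities.Theorems.HomologicalConductor.PersistenceAddCoverFamily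
open Summit.ResolutionOfSingularities.ResolutionOfSingularities.Theorems.HomologicalConductor.PersistenceCyclicQuotientAddCover

universe u

namespace Summit.ResolutionOfSingularities.ResolutionOfSingularities.Theorems.HomologicalConductor.PersistenceCyclicQuotientIsotypic

/-! ## Isotypic splitting for a finite abelian group of invertible order (abstract) -/

section Abelian

variable {U V : Type u} [CommRing U] [CommRing V] [Algebra U V]
variable {G : Type} [CommGroup G] [Fintype G] [DecidableEq G]

/-- **ISOTYPIC SPLITTING (finite group, characters indexed by the group through a bicharacter).**  `χ : G → G → U` multiplicative in both variables with
`χ 1 g = χ x 1 = 1` and BOTH orthogonalities, `|G| ∈ Uˣ`.  Then the `χ x`-isotypic pieces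
`M x = {v | σ g v = χ x g · v ∀ g}` are `U`-submodules of `V|_U` and `V|_U ≅ Π x, M x` (`v ↦ (|G|⁻¹ P_x v)_x`,
`P_x = ∑_g χ x g⁻¹ σ_g`; inverse = summation).  (`U → V` an algebra, `σ : G →* (V →ₐ[U] V)`.) [folklore] -/
theorem exists_isotypic_splitting_group (σ : G →* (V →ₐ[U] V)) (χ : G → G → U) (hχone₁ : ∀ g, χ 1 g = 1) (hχmul₁ : ∀ x x' g, χ (x * x') g = χ x g * χ x' g)
    (hχone₂ : ∀ x, χ x 1 = 1) (hχmul₂ : ∀ x g h, χ x (g * h) = χ x g * χ x h)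
    (horth₁ : ∀ x : G, x ≠ 1 → ∑ g, χ x g = 0) (horth₂ : ∀ g : G, g ≠ 1 → ∑ x, χ x g = 0)
    (hGU : IsUnit ((Fintype.card G : ℕ) : U)) :
    ∃ M : G → Submodule U ((restrictScalarsFunctor U V).obj (ModuleCat.of V V)),
      (∀ (x : G) (v : V), (show ((restrictScalarsFunctor U V).obj (ModuleCat.of V V)) from v) ∈ M x ↔ ∀ g, σ g v = algebraMap U V (χ x g) * v) ∧
      Nonempty (((restrictScalarsFunctor U V).obj (ModuleCat.of V V)) ≅ ModuleCat.of U (Π x, M x)) := by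
  classical
  -- `χ x g⁻¹ = χ x⁻¹ g`, both inverse to `χ x g`
  have hχinv : ∀ x g, χ x g⁻¹ = χ x⁻¹ g := by
    intro x g
    have h1 : χ x g * χ x g⁻¹ = 1 := by rw [← hχmul₂, mul_inv_cancel, hχone₂]
    have h2 : χ x g * χ x⁻¹ g = 1 := by rw [← hχmul₁, mul_inv_cancel, hχone₁]
    have hu : IsUnit (χ x g) := IsUnit.of_mul_eq_one _ h1
    exact hu.mul_left_cancel (h1.trans h2.symm)
  -- the carrier `W = V|_U`
  let toW : V → ((restrictScalarsFunctor U V).obj (ModuleCat.of V V)) := fun v => v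
  let ofW : ((restrictScalarsFunctor U V).obj (ModuleCat.of V V)) → V := fun w => w
  -- the isotypic submodules (character `χ x`)
  let M : G → Submodule U ((restrictScalarsFunctor U V).obj (ModuleCat.of V V)) := fun x =>
    { carrier := {w | ∀ g, σ g (ofW w) = algebraMap U V (χ x g) * ofW w}
      add_mem' := fun {w w'} hw hw' g => by
        change σ g (ofW w + ofW w') = _ * (ofW w + ofW w')
        rw [map_add, hw g, hw' g, mul_add]
      zero_mem' := fun g => by
        change σ g 0 = _ * 0
        rw [map_zero, mul_zero]
      smul_mem' := fun c {w} hw g => by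
        change σ g (algebraMap U V c * ofW w) = _ * (algebraMap U V c * ofW w)
        rw [map_mul, AlgHom.commutes, hw g]
        ring }
  have hM : ∀ x w, w ∈ M x ↔ ∀ g, σ g (ofW w) = algebraMap U V (χ x g) * ofW w := fun _ _ => Iff.rfl
  -- `|G|⁻¹ ∈ U`
  obtain ⟨cU, hcU⟩ : ∃ cU : U, cU * ((Fintype.card G : ℕ) : U) = 1 := ⟨(hGU.unit⁻¹ : Uˣ), hGU.unit.inv_mul⟩
  -- the isotypic projector `P_x = ∑_g χ x g⁻¹ σ_g`
  let P : G → V →ₗ[U] V := fun x =>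
    { toFun := fun v => ∑ g, algebraMap U V (χ x g⁻¹) * σ g v
      map_add' := fun v w => by
        rw [← Finset.sum_add_distrib]
        exact Finset.sum_congr rfl fun g _ => by rw [map_add, mul_add]
      map_smul' := fun c v => by
        rw [RingHom.id_apply, Algebra.smul_def, Algebra.smul_def, Finset.mul_sum]
        exact Finset.sum_congr rfl fun g _ => by rw [map_mul, AlgHom.commutes]; ring }
  have P_apply : ∀ x v, P x v = ∑ g, algebraMap U V (χ x g⁻¹) * σ g v := fun _ _ => rfl
  have P_char : ∀ x h v, σ h (P x v) = algebraMap U V (χ x h) * P x v := fun x h v => by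
    rw [P_apply]; exact apply_projector_eq_group σ χ hχmul₂ x h v
  have P_sum : ∀ v, ∑ x, P x v = ((Fintype.card G : ℕ) : V) * v := fun v => by
    simp only [P_apply]; exact sum_projector_eq_group σ χ hχone₂ horth₂ v
  have P_on_char : ∀ x y (m : V), (∀ g, σ g m = algebraMap U V (χ y g) * m) →
      P x m = if x = y then ((Fintype.card G : ℕ) : V) * m else 0 := by
    intro x y m hm
    rw [P_apply]
    have : ∀ g, algebraMap U V (χ x g⁻¹) * σ g m = algebraMap U V (χ (y * x⁻¹) g) * m := fun g => by
      rw [hm g, ← mul_assoc, ← map_mul, hχinv, ← hχmul₁, mul_comm x⁻¹ y]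
    rw [Finset.sum_congr rfl fun g _ => this g, ← Finset.sum_mul, ← map_sum]
    by_cases hxy : x = y
    · subst hxy
      rw [mul_inv_cancel, if_pos rfl]
      simp [hχone₁]
    · rw [horth₁ (y * x⁻¹) (fun h => hxy (mul_inv_eq_one.mp h).symm), map_zero, zero_mul, if_neg hxy]
  -- the scaled projector into `M x`
  let π : (x : G) → ((restrictScalarsFunctor U V).obj (ModuleCat.of V V)) →ₗ[U] M x := fun x =>
    { toFun := fun w => ⟨toW (algebraMap U V cU * P x (ofW w)), fun g => by
          change σ g (algebraMap U V cU * P x (ofW w)) = _ * (algebraMap U V cU * P x (ofW w))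
          rw [map_mul, AlgHom.commutes, P_char]; ring⟩
      map_add' := fun w w' => by
        apply Subtype.ext
        change algebraMap U V cU * P x (ofW w + ofW w') =
          algebraMap U V cU * P x (ofW w) + algebraMap U V cU * P x (ofW w')
        rw [map_add, mul_add]
      map_smul' := fun c w => by
        apply Subtype.ext
        change algebraMap U V cU * P x (algebraMap U V c * ofW w) =
          algebraMap U V c * (algebraMap U V cU * P x (ofW w))
        rw [show algebraMap U V c * ofW w = c • ofW w from (Algebra.smul_def c (ofW w)).symm, map_smul,
          Algebra.smul_def]
        ring }
  have π_val : ∀ x w, ofW ((π x w : M x) : ((restrictScalarsFunctor U V).obj (ModuleCat.of V V))) = algebraMap U V cU * P x (ofW w) := fun _ _ => rfl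
  let Φ : ((restrictScalarsFunctor U V).obj (ModuleCat.of V V)) →ₗ[U] (Π x, M x) := LinearMap.pi π
  have Φ_apply : ∀ w x, Φ w x = π x w := fun _ _ => rfl
  -- `ofW` as an additive map (to push it through sums)
  let ofWh : ((restrictScalarsFunctor U V).obj (ModuleCat.of V V)) →+ V := { toFun := ofW, map_zero' := rfl, map_add' := fun _ _ => rfl }
  have ofWh_apply : ∀ w, ofWh w = ofW w := fun _ => rfl
  have ofW_inj : Function.Injective ofW := fun _ _ h => h
  -- `∑_x π_x = id`
  have hsum : ∀ w : ((restrictScalarsFunctor U V).obj (ModuleCat.of V V)), (∑ x, ((π x w : M x) : ((restrictScalarsFunctor U V).obj (ModuleCat.of V V)))) = w := by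
    intro w
    apply ofW_inj
    rw [← ofWh_apply, map_sum]
    simp only [ofWh_apply, π_val]
    rw [← Finset.mul_sum, P_sum, ← mul_assoc, ← map_natCast (algebraMap U V), ← map_mul, hcU, map_one, one_mul]
  -- `π_x` on `M_y`
  have hπ : ∀ (x y : G) (m : M y), ofW ((π x (m : ((restrictScalarsFunctor U V).obj (ModuleCat.of V V))) : M x) : ((restrictScalarsFunctor U V).obj (ModuleCat.of V V))) =
      if x = y then ofW (m : ((restrictScalarsFunctor U V).obj (ModuleCat.of V V))) else 0 := by
    intro x y m
    rw [π_val, P_on_char x y _ ((hM y _).mp m.2)]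
    by_cases hxy : x = y
    · subst hxy
      rw [if_pos rfl, if_pos rfl, ← mul_assoc, ← map_natCast (algebraMap U V), ← map_mul, hcU, map_one, one_mul]
    · rw [if_neg hxy, if_neg hxy, mul_zero]
  have hΦinj : Function.Injective Φ := by
    intro w w' h
    rw [← hsum w, ← hsum w']
    exact Finset.sum_congr rfl fun x _ => by rw [← Φ_apply, ← Φ_apply, h]
  have hΦsurj : Function.Surjective Φ := by
    intro f
    refine ⟨∑ y, ((f y : M y) : ((restrictScalarsFunctor U V).obj (ModuleCat.of V V))), ?_⟩
    funext x
    rw [Φ_apply, map_sum]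
    apply Subtype.ext
    apply ofW_inj
    rw [Submodule.coe_sum, ← ofWh_apply, map_sum]
    simp only [ofWh_apply, hπ]
    rw [Finset.sum_ite_eq, if_pos (Finset.mem_univ _)]
  exact ⟨M, fun x v => hM x (toW v), ⟨(LinearEquiv.ofBijective Φ ⟨hΦinj, hΦsurj⟩).toModuleIso⟩⟩

end Abelian

/-! ## The cyclic quotient surface `1/n(1,q)` -/

section Cyclic

variable {k : Type u} [Field k] {n : ℕ} [NeZero n] {ζ : k} (hζ : IsPrimitiveRoot ζ n) (hn : (n : k) ≠ 0)
variable {q : ℕ} (hq : q.Coprime n) (U : Subalgebra k (MvPolynomial (Fin 2) k))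
variable (hU : ∀ p, p ∈ U ↔ aeval (fun i : Fin 2 => C (ζ ^ (![1, q] : Fin 2 → ℕ) i) * X i) p = p)

include hζ hn hq hU in
/-- **THE ISOTYPIC SPLITTING `k[u,v]|_U ≅ Π_a M_a` over `U = k[u,v]^{μ_n(1,q)}`.**  There are `U`-submodules
`M a` of `k[u,v]|_U` (`a : ZMod n`), `p ∈ M a ↔ σ₀ p = ζ^{a} · p` (semi-invariants of weight `a`; `M 0 = U`), and a
`U`-linear isomorphism `k[u,v]|_U ≅ Π a, M a`. [folklore; OURS · L1 w44b] -/
theorem exists_isotypic_splitting :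
    ∃ M : ZMod n → Submodule U ((restrictScalarsFunctor U (MvPolynomial (Fin 2) k)).obj
        (ModuleCat.of (MvPolynomial (Fin 2) k) (MvPolynomial (Fin 2) k))),
      (∀ (a : ZMod n) (p : MvPolynomial (Fin 2) k),
        (show ((restrictScalarsFunctor U (MvPolynomial (Fin 2) k)).obj
          (ModuleCat.of (MvPolynomial (Fin 2) k) (MvPolynomial (Fin 2) k))) from p) ∈ M a ↔
        aeval (fun i : Fin 2 => C (ζ ^ (![1, q] : Fin 2 → ℕ) i) * X i) p = C (ζ ^ a.val) * p) ∧
      Nonempty ((restrictScalarsFunctor U (MvPolynomial (Fin 2) k)).obj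
          (ModuleCat.of (MvPolynomial (Fin 2) k) (MvPolynomial (Fin 2) k)) ≅ ModuleCat.of U (Π a, M a)) := by
  classical
  set σ₀ := aeval (R := k) (fun i : Fin 2 => C (ζ ^ (![1, q] : Fin 2 → ℕ) i) * X i) with hσ₀
  obtain ⟨σ, χ, hσ, -, hχval, hχone₁, hχmul₁, hχone₂, hχmul₂, horth, hGU, -, -⟩ :=
    exists_standardData hζ hn hq U hU
  have hζn : ζ ^ n = 1 := hζ.pow_eq_one
  have hinj : Function.Injective (algebraMap U (MvPolynomial (Fin 2) k)) := Subtype.val_injective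
  have hCm : ∀ (m : ℕ) (a : k), (σ₀ ^ m) (C a) = C a := fun m a => (σ₀ ^ m).commutes a
  -- FIRST orthogonality of the (symmetric) bicharacter
  have horth₁ : ∀ x : Multiplicative (ZMod n), x ≠ 1 → ∑ g, χ x g = 0 := by
    intro x hx
    apply hinj
    rw [map_sum, map_zero]
    have h1 : ∀ g, algebraMap U (MvPolynomial (Fin 2) k) (χ x g) =
        C (ζ ^ ((Multiplicative.toAdd g).val * (Multiplicative.toAdd x).val)) := fun g => by
      rw [hχval, Nat.mul_comm]
    rw [Finset.sum_congr rfl fun g _ => h1 g, ← map_sum,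
      sum_pow_val_mul_val_eq_zero (sum_pow_mul_eq_zero_of_isPrimitiveRoot hζ) x hx, C_0]
  -- the dictionary `σ₀`-eigenvector ↔ character `χ (ofAdd a)`
  have htrans : ∀ (a : ZMod n) (b : MvPolynomial (Fin 2) k),
      ((∀ g, σ g b = algebraMap U _ (χ (Multiplicative.ofAdd a) g) * b) ↔ σ₀ b = C (ζ ^ a.val) * b) := by
    intro a b
    constructor
    · intro h
      have := h (Multiplicative.ofAdd 1)
      rw [hσ, hχval, toAdd_ofAdd, toAdd_ofAdd] at this
      rcases Nat.lt_or_ge 1 n with h1 | h1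
      · haveI hfact : Fact (1 < n) := ⟨h1⟩
        rw [ZMod.val_one, pow_one, mul_one] at this
        rw [hσ₀]; exact this
      · have hn1 : n = 1 := le_antisymm h1 (NeZero.one_le)
        subst hn1
        have hz : ζ = 1 := by simpa using hζn
        have hid : σ₀ = AlgHom.id k (MvPolynomial (Fin 2) k) := by
          apply MvPolynomial.algHom_ext; intro i; rw [hσ₀, rootAut_X, hz, one_pow, C_1, one_mul]; rfl
        rw [hid, AlgHom.id_apply, hz, one_pow, C_1, one_mul]
    · intro h g
      rw [hχval, toAdd_ofAdd, show g = Multiplicative.ofAdd (Multiplicative.toAdd g) from rfl, hσ, toAdd_ofAdd]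
      generalize (Multiplicative.toAdd g).val = m
      induction m with
      | zero => simp
      | succ m ih =>
        rw [pow_succ, AlgHom.mul_apply, ← hσ₀, h, map_mul, hσ₀, ih, ← hσ₀, hCm, ← mul_assoc, ← C_mul, ← pow_add,
          show a.val + a.val * m = a.val * (m + 1) by ring]
  obtain ⟨M, hM, ⟨e⟩⟩ := exists_isotypic_splitting_group σ χ hχone₁ hχmul₁ hχone₂ hχmul₂ horth₁ horth hGU
  refine ⟨fun a => M (Multiplicative.ofAdd a), fun a p => (hM _ p).trans (htrans a p), ⟨e ≪≫ ?_⟩⟩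
  exact (LinearEquiv.piCongrLeft' U (fun x => (M x : Type u)) Multiplicative.toAdd).toModuleIso

include hζ hn hq hU in
/-- **`Sat₄` AND THE EXACT CENTRE AT `1/n(1,q)` FROM ISOTYPIC DATA (parts 16 + 17 assembled).**  For the modules
`M a` of an isotypic splitting `k[u,v]|_U ≅ Π a, M a`: first syzygies `K a` with `K a ∈ add ((Π t, M (ψ t)) ⊕ U)`
for a distinguished sub-family `ψ : κ → ZMod n`, and retracts `M (ψ t) | K (ψ (s t))`, give `ca(U) = ca⁴(U)` and
`x ∈ ca(U) ↔ ∀ t, x ∈ s̲ann(M (ψ t))`. [OURS · L1 w44b] -/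
theorem cohomologyAnnihilator_eq_four_of_isotypicData {κ : Type} [Fintype κ]
    (M : ZMod n → ModuleCat.{u} U)
    (e : (restrictScalarsFunctor U (MvPolynomial (Fin 2) k)).obj
        (ModuleCat.of (MvPolynomial (Fin 2) k) (MvPolynomial (Fin 2) k)) ≅ ModuleCat.of U (Π a, M a))
    (K : ZMod n → ModuleCat.{u} U) (hK : ∀ a, IsSyzygy 1 (M a) (K a)) (ψ : κ → ZMod n)
    [∀ t, Module.Finite U (M (ψ t))]
    (hKD : ∀ a, IsRetractOfPower (ModuleCat.of U ((Π t, M (ψ t)) × U)) (K a))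
    (hD : ∀ t, ∃ (s : κ) (i : M (ψ t) ⟶ K (ψ s)) (r : K (ψ s) ⟶ M (ψ t)), i ≫ r = 𝟙 (M (ψ t))) :
    cohomologyAnnihilator U = cohomologyAnnihilatorOfDegree U 4 ∧
      ∀ x : U, x ∈ cohomologyAnnihilator U ↔ ∀ t, StablyAnnihilates U x (M (ψ t)) := by
  haveI := isNoetherianRing_cyclicQuotient hζ hn q U hU
  exact ⟨cohomologyAnnihilator_eq_of_summandData 2 (isRetractOfPower_of_isSyzygy_two_cyclicQuotient hζ hn hq U hU)
      M K e hK ψ hKD hD,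
    mem_cohomologyAnnihilator_iff_forall_stablyAnnihilates_of_summandData 2
      (isRetractOfPower_of_isSyzygy_two_cyclicQuotient hζ hn hq U hU) M K e hK ψ hKD hD⟩

end Cyclic

end Summit.ResolutionOfSingularities.ResolutionOfSingularities.Theorems.HomologicalConductor.PersistenceCyclicQuotientIsotypic

end
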